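import Literature.Probability.Percolation.OneArmMaximumPrinciple
import HarnessLib

/-!
# The one-arm exponent: LSW's comparison (2.17) with explicit constants

Topic `Probability/Percolation`; one theorem, a sequel of `OneArmMaximumPrinciple`. The tree's
`LawlerSchrammWerner2002_comparison` (LSW (2002), proof of Theorem 1.2, p. 8) produces the two-sided
bound `c H ≤ h̃ ≤ c' H` on `[0, 2π] × [1, ∞)` with constants `c, c'` obtained by compactness from
the positivity of `h̃`. For the application to a FAMILY of solutions (the renewal extensions of the
hitting functions of all subsequential scaling limits, where uniformity of the constants is the
whole point) we record the **explicit dependence of the constants**, which the tree's proof already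
exhibits: `c' = (1 + π²)/H(π, 1) + π²/H(1, 0)` depends on `κ` only, and `c = 1/c₂` with
`c₂ = (1 + π²)/m₁ + π²/m₂ + 1/m₃`, where `m₁, m₂, m₃ > 0` are lower bounds of `h̃` on the three
segments `{π} × [0, 1]`, `[1, π] × {0}`, `[π, 2π] × {1}` (`LawlerSchrammWerner2002_comparison_explicit`).
The proof is the tree's, with the three minima replaced by the given lower bounds.

## References

* G. F. Lawler, O. Schramm, W. Werner, *One-arm exponent for critical 2D percolation*, Electron.
  J. Probab. 7 (2002), no. 2, proof of Theorem 1.2 (p. 8), (2.17). [LawlerSchrammWernerEJP2002]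
-/

noncomputable section

open Real Filter Topology Set

namespace Literature.Probability.Percolation

variable {κ : ℝ} {g gθ gθθ gt : ℝ → ℝ → ℝ}

/-- **LSW's (2.17) with explicit constants**: under the hypotheses of
`LawlerSchrammWerner2002_comparison` except positivity, and given positive lower bounds `m₁` of
`g` on `{π} × [0, 1]`, `m₂` on `[1, π] × {0}` and `m₃` on `[π, 2π] × {1}`, for all `t ≥ 1` and
`θ ∈ [0, 2π]`: `H(θ, t)/c₂ ≤ g(θ, t) ≤ c₁ H(θ, t)` with
`c₂ = (1 + π²)/m₁ + π²/m₂ + 1/m₃` and `c₁ = (1 + π²)/(sin(π/4)^q e^{-λ}) + π²/sin(1/4)^q`.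
[cite: LawlerSchrammWernerEJP2002, proof of Thm. 1.2 (p. 8)] -/
theorem LawlerSchrammWerner2002_comparison_explicit (hκ : 4 < κ)
    (hcont : ContinuousOn (fun p : ℝ × ℝ => g p.1 p.2) (Icc 0 (2 * π) ×ˢ Ici 0))
    (hderθ : ∀ θ ∈ Ioo 0 (2 * π), ∀ t ∈ Ioi (0 : ℝ), HasDerivAt (fun x => g x t) (gθ θ t) θ)
    (hderθθ : ∀ θ ∈ Ioo 0 (2 * π), ∀ t ∈ Ioi (0 : ℝ), HasDerivAt (fun x => gθ x t) (gθθ θ t) θ)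
    (hdert : ∀ θ ∈ Ioo 0 (2 * π), ∀ t ∈ Ioi (0 : ℝ), HasDerivAt (fun s => g θ s) (gt θ t) t)
    (hpde : ∀ θ ∈ Ioo 0 (2 * π), ∀ t ∈ Ioi (0 : ℝ), lswOp κ θ (gθθ θ t) (gθ θ t) (gt θ t) = 0)
    (hdir : ∀ t, 0 < t → g 0 t = 0)
    (hneu : ∀ t, 0 < t → HasDerivWithinAt (fun x => g x t) 0 (Iic (2 * π)) (2 * π))
    (hbd : ∀ θ ∈ Icc 0 (2 * π), ∀ t, 0 ≤ t → g θ t ∈ Icc (0 : ℝ) 1)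
    {m₁ m₂ m₃ : ℝ} (hm₁ : 0 < m₁) (hm₂ : 0 < m₂) (hm₃ : 0 < m₃)
    (hg₁ : ∀ t ∈ Icc (0 : ℝ) 1, m₁ ≤ g π t) (hg₂ : ∀ θ ∈ Icc (1 : ℝ) π, m₂ ≤ g θ 0)
    (hg₃ : ∀ θ ∈ Icc π (2 * π), m₃ ≤ g θ 1) :
    ∀ t, 1 ≤ t → ∀ θ ∈ Icc 0 (2 * π),
      lswH κ θ t / ((1 + π ^ 2) / m₁ + π ^ 2 / m₂ + 1 / m₃) ≤ g θ t ∧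
      g θ t ≤ ((1 + π ^ 2) / (Real.sin (π / 4) ^ lswQ κ * Real.exp (-(lswLambda κ * 1))) +
        π ^ 2 / (Real.sin (1 / 4) ^ lswQ κ * Real.exp (-(lswLambda κ * 0)))) * lswH κ θ t := by
  have hπ := Real.pi_pos
  have hπ3 : (3 : ℝ) < π := Real.pi_gt_three
  have hA0 : 0 < Real.sin (π / 4) ^ lswQ κ * Real.exp (-(lswLambda κ * 1)) :=
    mul_pos (Real.rpow_pos_of_pos (sin_quarter_pos hπ (by linarith)) _) (Real.exp_pos _)
  have hB0 : 0 < Real.sin (1 / 4) ^ lswQ κ * Real.exp (-(lswLambda κ * 0)) :=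
    mul_pos (Real.rpow_pos_of_pos (sin_quarter_pos one_pos (by linarith)) _) (Real.exp_pos _)
  set A := Real.sin (π / 4) ^ lswQ κ * Real.exp (-(lswLambda κ * 1)) with hA
  set B := Real.sin (1 / 4) ^ lswQ κ * Real.exp (-(lswLambda κ * 0)) with hB
  set c₁ : ℝ := (1 + π ^ 2) / A + π ^ 2 / B with hc₁
  set c₂ : ℝ := (1 + π ^ 2) / m₁ + π ^ 2 / m₂ + 1 / m₃ with hc₂
  have hc₁0 : 0 < c₁ := by positivity
  have hc₂0 : 0 < c₂ := by positivity
  have hxA : 0 ≤ (1 + π ^ 2) / A := by positivity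
  have hxB : 0 ≤ π ^ 2 / B := by positivity
  have hx₁ : 0 ≤ (1 + π ^ 2) / m₁ := by positivity
  have hx₂ : 0 ≤ π ^ 2 / m₂ := by positivity
  have hx₃ : 0 ≤ 1 / m₃ := by positivity
  have hc₁A : 1 + π ^ 2 ≤ c₁ * A := by
    have e : (1 + π ^ 2) / A * A = 1 + π ^ 2 := div_mul_cancel₀ _ hA0.ne'
    have : c₁ * A = (1 + π ^ 2) / A * A + π ^ 2 / B * A := by rw [hc₁]; ring
    rw [this, e]; linarith [mul_nonneg hxB hA0.le]
  have hc₁B : π ^ 2 ≤ c₁ * B := by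
    have e : π ^ 2 / B * B = π ^ 2 := div_mul_cancel₀ _ hB0.ne'
    have : c₁ * B = (1 + π ^ 2) / A * B + π ^ 2 / B * B := by rw [hc₁]; ring
    rw [this, e]; linarith [mul_nonneg hxA hB0.le]
  have hc₂m₁ : 1 + π ^ 2 ≤ c₂ * m₁ := by
    have e : (1 + π ^ 2) / m₁ * m₁ = 1 + π ^ 2 := div_mul_cancel₀ _ hm₁.ne'
    have : c₂ * m₁ = (1 + π ^ 2) / m₁ * m₁ + π ^ 2 / m₂ * m₁ + 1 / m₃ * m₁ := by rw [hc₂]; ring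
    rw [this, e]; linarith [mul_nonneg hx₂ hm₁.le, mul_nonneg hx₃ hm₁.le]
  have hc₂m₂ : π ^ 2 ≤ c₂ * m₂ := by
    have e : π ^ 2 / m₂ * m₂ = π ^ 2 := div_mul_cancel₀ _ hm₂.ne'
    have : c₂ * m₂ = (1 + π ^ 2) / m₁ * m₂ + π ^ 2 / m₂ * m₂ + 1 / m₃ * m₂ := by rw [hc₂]; ring
    rw [this, e]; linarith [mul_nonneg hx₁ hm₂.le, mul_nonneg hx₃ hm₂.le]
  have hc₂m₃ : 1 ≤ c₂ * m₃ := by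
    have e : 1 / m₃ * m₃ = 1 := div_mul_cancel₀ _ hm₃.ne'
    have : c₂ * m₃ = (1 + π ^ 2) / m₁ * m₃ + π ^ 2 / m₂ * m₃ + 1 / m₃ * m₃ := by rw [hc₂]; ring
    rw [this, e]; linarith [mul_nonneg hx₁ hm₃.le, mul_nonneg hx₂ hm₃.le]
  -- Step 1 on `[0, π] × [0, 1]`
  have hcont1 : ContinuousOn (fun p : ℝ × ℝ => g p.1 p.2) (Icc 0 π ×ˢ Icc 0 1) :=
    hcont.mono (prod_mono (Icc_subset_Icc le_rfl (by linarith)) Icc_subset_Ici_self)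
  have step1u := lsw_comparison_step1_upper hκ hcont1 hderθ hderθθ hdert hpde hdir hbd hc₁0.le
    hc₁A hc₁B
  have step1l := lsw_comparison_step1_lower hκ hcont1 hderθ hderθθ hdert hpde hbd hg₁ hg₂
    hc₂0.le hc₂m₁ hc₂m₂
  -- Step 2: the inequalities at `t = 1` on all of `[0, 2π]`
  have step2u : ∀ θ ∈ Icc 0 (2 * π), g θ 1 ≤ c₁ * lswH κ θ 1 := by
    intro θ hθ
    rcases le_or_gt θ π with hθπ | hθπ
    · have := step1u θ ⟨hθ.1, hθπ⟩; nlinarith [sq_nonneg θ]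
    · have hg := (hbd θ hθ 1 zero_le_one).2
      have hH : c₁ * A ≤ c₁ * lswH κ θ 1 :=
        mul_le_mul_of_nonneg_left (lswH_ge hκ hπ.le hθπ.le hθ.2 le_rfl) hc₁0.le
      nlinarith [sq_nonneg π]
  have step2l : ∀ θ ∈ Icc 0 (2 * π), lswH κ θ 1 ≤ c₂ * g θ 1 := by
    intro θ hθ
    rcases le_or_gt θ π with hθπ | hθπ
    · have := step1l θ ⟨hθ.1, hθπ⟩; nlinarith [sq_nonneg θ]
    · have hH1 : lswH κ θ 1 ≤ 1 := lswH_le_one hκ hθ.1 hθ.2 zero_le_one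
      have hgm : c₂ * m₃ ≤ c₂ * g θ 1 := mul_le_mul_of_nonneg_left (hg₃ θ ⟨hθπ.le, hθ.2⟩) hc₂0.le
      linarith
  -- Step 3 on `[0, 2π] × [1, ∞)`
  have hcont3 : ContinuousOn (fun p : ℝ × ℝ => g p.1 p.2) (Icc 0 (2 * π) ×ˢ Ici 1) :=
    hcont.mono (prod_mono le_rfl (Ici_subset_Ici.2 zero_le_one))
  have step3 := lsw_comparison_step3 hκ hcont3 hderθ hderθθ hdert hpde hdir hneu step2u step2l
  intro t ht θ hθ
  have := step3 t ht θ hθ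
  constructor
  · rw [div_le_iff₀ hc₂0]
    linarith [this.2]
  · exact this.1

end Literature.Probability.Percolation
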